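import Summits.QuantumFields.BalabanUV.Beta.D1BFx.LocalVertexForm
import Summits.QuantumFields.BalabanUV.Beta.D1BFx.GluonBubbleTails

/-!
# `BalabanUV.Beta.D1BFx.LocalVertexBound` — road «BF-x» for binder row D1, slot (K), END row `hGrp gN`, «GN-T12 ∕ FRAME» (part 2): THE WINDOW ESTIMATE
# FOR A LIST VERTEX OF GRADING 1 AGAINST TWO LEG ENDS, `|vtx z L F G| ≤ K·(Φ₁Γ₀ + Φ₀Γ₁ + Φ₁Γ₁)`, and its instance for the transverse-completed
# Wilson sector: `|biBubble A (SbT κ u) B (φ ⊗ ψ)| ≤ K·(Φ₁Γ₀ + Φ₀Γ₁ + Φ₁Γ₁)` with ABSOLUTE `K`, `R` — the vertex's one difference always lands on a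
# leg end (`Φ₀Γ₀` never occurs): the frame of the six `SbT` pieces of the gluon needle rows T₁ ∕ T₂

HONEST DEPENDENCY (cell records, verbatim): «continuum YM on T⁴ ⇐ BetaPertH ∧ nine spine estimates (0/9 proved); BetaPertH ⇐ (D1) ∧ (D4) ∧
CAP+tail; G-an2-4 gates asym, D1 and NE2/3/4.»  HONEST FRAMING (cell contract, verbatim): «discharging `BetaPertH` makes Bałaban's UV stability
UNCONDITIONAL — a real constructive-QFT result; it is NOT the continuum limit and NOT the Clay problem.»  THIS MODULE DISCHARGES NOTHING of the
wall: [folklore] finite bookkeeping over part 1 `LocalVertexForm` (`vtx`, `iterΔ`, `VTerm`, `exists_vterms_of_graded`, `biBubble_realK_outer`) and an3's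
`Graded` ∕ `IsStep` (`GradedBubbles`), leaf-03-g12's `GluonBubbleTails` (`SbT_eq_realK`, `graded_SbT_list` — the list form and grading of `SbT`), `SectorRecut` (`SbT`).
No `def`, no `def … : Prop`, nothing cited, no hypothesis is a printed statement, 0 sorry.  Asserts NO bound on any table of the road: the window bounds
`Φ₀ Φ₁ Γ₀ Γ₁` are HYPOTHESES to be fed by letters.  Root-level binders hW ∕ hR-sockets ∕ hSX-socket ∕ D1Tel ∕ D1Rep — 0 discharged; (K) NOT closed;
NOT D1, NOT `BetaPertH`, NOT continuum, NOT Clay.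

ABSOLUTE RULE (cell charter, verbatim): «No internally-minted statement may enter as a cited fact. Every hypothesis is either kernel-proved in
this package or a verbatim quotation of a PUBLISHED theorem with page reference. The manuscript(s) under audit are NOT citable for their own
disputed steps — they are the thing under adjudication; programme-internal (2001/route/tribunal) claims are never citable.»

WHY (owner records `HOME/b2b-balaban-beta-d1-p2/GLUON-NEEDLE-ROWS.md` v0.2 «GN-CELLS» rows T₁∕T₂ P∕K∕Q̇-pieces; an3-g57 `N36-SPLIT.v1.md` §3′ (4)).  With
part 1 the word of a T₁ piece is `vtx (b+w) L (ψ·Ga) (Ga·φ)`; bi-localisation of `SbT` alone leaves the cell short by `n¹`; the grading-1 structure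
(`SbT = VEC + REMₐ`, `Graded 1`) puts one lattice difference on a leg END, where the D1 letters of the legs (`GluonLegProfileD1`, `exists_sum_B_abs_Ga_diff_le`)
pay it.  This part turns the unfolding into ONE inequality with absolute constants, in the currency the cell files consume.
* §4 [folklore] list-sum helpers, `abs_fdiffB_le_of_step`, `abs_iterΔ_cons_le`, `abs_sum_sum_mul_mul_le`, `abs_eval_le`, **`exists_vtx_bound_of_graded_one`**.
* §5 [folklore] **`exists_SbT_outer_bound`** (over leaf-03-g12's `GluonBubbleTails.SbT_eq_realK` ∕ `graded_SbT_list`: `SbT κ u = realK u u (reixStn ιU (vec₀ κ ++ rem₀ κ))`, grading 1).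
NOT HERE (honest): any letter, any (1.22) sum, any cell bound; the mirror placement (T₂).  Unit `b2b-balaban-beta-d1-p2` (gen 10), road «BF-x» OWNER;
`LEAVES-BFx.md` row (N) «GN-T12 ∕ FRAME» part 2.
-/

noncomputable section

namespace Summit.QuantumFields.BalabanUV.Beta.D1BFx.LocalVertexForm

open Finset
open scoped BigOperators
open Literature.MathematicalPhysics.QuantumFieldTheory.Balaban1983to89
open Literature.MathematicalPhysics.QuantumFieldTheory.Balaban1983to89.Beta
open ExpKernelCalculus (Site MKer comp tr)
open DyadicShell (Pt supNorm)
open BubbleTransfer (unitVec)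
open GradedBubbles (LP Stn rowSh colSh smulS rowDiff colDiff Graded IsStep)
open Summit.QuantumFields.BalabanUV.Beta.D1BFx.StencilRealisation (realK)
open Summit.QuantumFields.BalabanUV.Beta.D1BFx.WilsonStencilRealised (reixStn ιU reixStn_nil reixStn_cons realK_append)
open Summit.QuantumFields.BalabanUV.Beta.D1BFx.ColourlessAntisymmetry (reixStn_append reixStn_smulS)
open Summit.QuantumFields.BalabanUV.Beta.D1BFx.CrossERestLists (vec₀ rem₀ div₀ graded_vec₀ graded_rem₀ SbE_eq_realK_lists)
open Summit.QuantumFields.BalabanUV.Beta.D1BFx.SectorRecut (SbT divK SbT_apply)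
open Summit.QuantumFields.BalabanUV.Beta.D1BFx.GluonBubbleTails (SbT_eq_realK graded_SbT_list)
open Summit.QuantumFields.BalabanUV.Beta.D1BFx.PackedKernelSplit (biBubble)
open Summit.QuantumFields.BalabanUV.Beta.D1BFx.RankOneBubble (outer applyK applyKT)

variable {I : Type*} [Fintype I]

/-! ## §4 The window estimate for grading 1 -/

section Bound

omit [Fintype I] in
/-- [folklore] `|Σ| ≤ Σ |·|` over a list. -/
theorem list_abs_sum_le {α : Type*} (l : List α) (f : α → ℝ) : |(l.map f).sum| ≤ (l.map fun t => |f t|).sum := by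
  induction l with
  | nil => simp
  | cons t l ih => rw [List.map_cons, List.map_cons, List.sum_cons, List.sum_cons]; exact (abs_add_le _ _).trans (by linarith)

omit [Fintype I] in
/-- [folklore] Termwise comparison of list sums. -/
theorem list_sum_le_sum {α : Type*} (l : List α) {f g : α → ℝ} (h : ∀ t ∈ l, f t ≤ g t) : (l.map f).sum ≤ (l.map g).sum := by
  induction l with
  | nil => simp
  | cons t l ih =>
    rw [List.map_cons, List.map_cons, List.sum_cons, List.sum_cons]
    exact add_le_add (h t List.mem_cons_self) (ih fun t' ht' => h t' (List.mem_cons_of_mem _ ht'))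

omit [Fintype I] in
/-- [folklore] A list sum of nonnegative reals is nonnegative. -/
theorem list_sum_nonneg {α : Type*} (l : List α) {f : α → ℝ} (h : ∀ t ∈ l, 0 ≤ f t) : 0 ≤ (l.map f).sum := by
  induction l with
  | nil => simp
  | cons t l ih =>
    rw [List.map_cons, List.sum_cons]
    exact add_nonneg (h t List.mem_cons_self) (ih fun t' ht' => h t' (List.mem_cons_of_mem _ ht'))

omit [Fintype I] in
/-- [folklore] A member is at most the list sum (naturals). -/
theorem list_le_sum_nat {α : Type*} (l : List α) (f : α → ℕ) {t : α} (ht : t ∈ l) : f t ≤ (l.map f).sum := by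
  induction l with
  | nil => simp at ht
  | cons t' l ih =>
    rw [List.map_cons, List.sum_cons]
    rcases List.mem_cons.1 ht with rfl | ht
    · exact Nat.le_add_right _ _
    · exact (ih ht).trans (Nat.le_add_left _ _)

omit [Fintype I] in
/-- [folklore] One unit step moves a point by at most one in the sup distance from the base point. -/
theorem supNorm_add_step_sub_le {a : Pt} (ha : IsStep a) (q z : Pt) : supNorm (q + a - z) ≤ supNorm (q - z) + 1 := by
  have e : q + a - z = (q - z) + a := by abel
  rw [e]
  calc supNorm (q - z + a) ≤ supNorm (q - z) + supNorm a := by exact_mod_cast BlockLegs.supNorm_add_le_real _ _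
    _ = supNorm (q - z) + 1 := by rw [ha.supNorm_eq]

variable (z : Pt) (R : ℕ)

omit [Fintype I] in
/-- [folklore] **ONE UNIT STEP (forward or backward) FROM FORWARD-DIFFERENCE BOUNDS**: if the forward unit differences of `F` are `≤ Φ₁` at window level
`k` (points `t` with `‖t − z‖∞ + k ≤ R`), then `|fdiffB a F q g| ≤ Φ₁` for every unit step `a` at level `k + 1` (a backward step is a forward step from
`q − e_i`, one unit further out). -/
theorem abs_fdiffB_le_of_step {F : Pt → I → ℝ} {Φ₁ : ℝ} {k : ℕ}
    (hF : ∀ (t : Pt) (g : I) (i : Fin 4), supNorm (t - z) + k ≤ R → |F (t + unitVec i) g - F t g| ≤ Φ₁)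
    {a : Pt} (ha : IsStep a) (q : Pt) (g : I) (hq : supNorm (q - z) + k + 1 ≤ R) : |fdiffB a F q g| ≤ Φ₁ := by
  obtain ⟨i, rfl | rfl⟩ := ha
  · exact hF q g i (by omega)
  · have hstep : IsStep (-unitVec i) := ⟨i, Or.inr rfl⟩
    have h1 := supNorm_add_step_sub_le hstep q z
    have := hF (q + -unitVec i) g i (by omega)
    rw [neg_add_cancel_right] at this
    rw [fdiffB_apply, abs_sub_comm]
    exact this

omit [Fintype I] in
/-- [folklore] **ITERATED UNIT DIFFERENCES FROM FORWARD-DIFFERENCE BOUNDS**: `|Δ_{a :: s} F (q)| ≤ 2^{|s|}·Φ₁` at window level `k + 2·(|s| + 1)`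
(each further step costs a factor `2` and two units of window: one for a possible backward base point, one for the forward evaluation point). -/
theorem abs_iterΔ_cons_le (s : List Pt) (hs : ∀ b ∈ s, IsStep b) :
    ∀ {a : Pt}, IsStep a → ∀ (F : Pt → I → ℝ) (Φ₁ : ℝ) (k : ℕ),
      (∀ (t : Pt) (g : I) (i : Fin 4), supNorm (t - z) + k ≤ R → |F (t + unitVec i) g - F t g| ≤ Φ₁) →
      ∀ (q : Pt) (g : I), supNorm (q - z) + k + 2 * (s.length + 1) ≤ R → |iterΔ (a :: s) F q g| ≤ 2 ^ s.length * Φ₁ := by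
  induction s with
  | nil =>
    intro a ha F Φ₁ k hF q g hq
    rw [iterΔ_cons, iterΔ_nil, List.length_nil, pow_zero, one_mul]
    exact abs_fdiffB_le_of_step z R hF ha q g (by omega)
  | cons b s ih =>
    intro a ha F Φ₁ k hF q g hq
    rw [iterΔ_cons]
    have hs' : ∀ b' ∈ s, IsStep b' := fun b' hb' => hs b' (List.mem_cons_of_mem _ hb')
    have hb : IsStep b := hs b List.mem_cons_self
    have hF' : ∀ (t : Pt) (g : I) (i : Fin 4), supNorm (t - z) + (k + 2) ≤ R →
        |fdiffB a F (t + unitVec i) g - fdiffB a F t g| ≤ 2 * Φ₁ := by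
      intro t g' i ht
      have hst : IsStep (unitVec i) := ⟨i, Or.inl rfl⟩
      have hmove := supNorm_add_step_sub_le hst t z
      have h1 : |fdiffB a F (t + unitVec i) g'| ≤ Φ₁ := abs_fdiffB_le_of_step z R hF ha (t + unitVec i) g' (by omega)
      have h2 : |fdiffB a F t g'| ≤ Φ₁ := abs_fdiffB_le_of_step z R hF ha t g' (by omega)
      calc _ ≤ |fdiffB a F (t + unitVec i) g'| + |fdiffB a F t g'| := by
            rw [sub_eq_add_neg]; exact (abs_add_le _ _).trans (by rw [abs_neg])
        _ ≤ Φ₁ + Φ₁ := add_le_add h1 h2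
        _ = 2 * Φ₁ := by ring
    have hq' : supNorm (q - z) + (k + 2) + 2 * (s.length + 1) ≤ R := by
      simp only [List.length_cons] at hq; omega
    calc |iterΔ (b :: s) (fdiffB a F) q g| ≤ 2 ^ s.length * (2 * Φ₁) := ih hs' hb (fdiffB a F) (2 * Φ₁) (k + 2) hF' q g hq'
      _ = 2 ^ (b :: s).length * Φ₁ := by rw [List.length_cons, pow_succ]; ring

/-- [folklore] A double fibre sum against two bounded families: `|Σ_{g f} m g f · X g · Y f| ≤ (Σ |m|)·bX·bY`. -/
theorem abs_sum_sum_mul_mul_le (m : Matrix I I ℝ) {X Y : I → ℝ} {bX bY : ℝ} (hbX : 0 ≤ bX)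
    (hX : ∀ g, |X g| ≤ bX) (hY : ∀ f, |Y f| ≤ bY) :
    |∑ g, ∑ f, m g f * X g * Y f| ≤ (∑ g, ∑ f, |m g f|) * bX * bY := by
  rw [sum_mul, sum_mul]
  refine (abs_sum_le_sum_abs _ _).trans (sum_le_sum fun g _ => ?_)
  rw [sum_mul, sum_mul]
  refine (abs_sum_le_sum_abs _ _).trans (sum_le_sum fun f _ => ?_)
  rw [abs_mul, abs_mul, mul_assoc, mul_assoc]
  exact mul_le_mul_of_nonneg_left (mul_le_mul (hX g) (hY f) (abs_nonneg _) hbX) (abs_nonneg _)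

/-- [folklore] **THE BOUND OF ONE UNFOLDED TERM WITH AT LEAST ONE STEP** from window bounds of radius `R ≥` the term's reach: values `Φ₀` ∕ unit
differences `Φ₁` of the row end, `Γ₀` ∕ `Γ₁` of the column end ⇒ `|t.eval| ≤ |c|·(Σ|m|)·2^{len}·(Φ₁Γ₀ + Φ₀Γ₁ + Φ₁Γ₁)` — the product `Φ₀Γ₀` never occurs. -/
theorem abs_eval_le (t : VTerm I) (hlen : 1 ≤ t.len) (hsF : ∀ a ∈ t.sF, IsStep a) (hsG : ∀ a ∈ t.sG, IsStep a)
    (hRx : supNorm t.x + 2 * t.sF.length ≤ R) (hRy : supNorm t.y + 2 * t.sG.length ≤ R)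
    {F G : Pt → I → ℝ} {Φ₀ Φ₁ Γ₀ Γ₁ : ℝ} (hΦ₀ : 0 ≤ Φ₀) (hΦ₁ : 0 ≤ Φ₁) (hΓ₀ : 0 ≤ Γ₀) (hΓ₁ : 0 ≤ Γ₁)
    (hF₀ : ∀ (q : Pt) (g : I), supNorm (q - z) ≤ R → |F q g| ≤ Φ₀)
    (hF₁ : ∀ (q : Pt) (g : I) (i : Fin 4), supNorm (q - z) ≤ R → |F (q + unitVec i) g - F q g| ≤ Φ₁)
    (hG₀ : ∀ (q : Pt) (f : I), supNorm (q - z) ≤ R → |G q f| ≤ Γ₀)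
    (hG₁ : ∀ (q : Pt) (f : I) (i : Fin 4), supNorm (q - z) ≤ R → |G (q + unitVec i) f - G q f| ≤ Γ₁) :
    |t.eval z F G| ≤ |t.c| * (∑ g, ∑ f, |t.m g f|) * 2 ^ t.len * (Φ₁ * Γ₀ + Φ₀ * Γ₁ + Φ₁ * Γ₁) := by
  have hx0 : supNorm (z + t.x - z) = supNorm t.x := by rw [add_sub_cancel_left]
  have hy0 : supNorm (z + t.y - z) = supNorm t.y := by rw [add_sub_cancel_left]
  have hm : 0 ≤ ∑ g, ∑ f, |t.m g f| := sum_nonneg fun _ _ => sum_nonneg fun _ _ => abs_nonneg _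
  have hS : 0 ≤ Φ₁ * Γ₀ + Φ₀ * Γ₁ + Φ₁ * Γ₁ := by positivity
  -- generic packaging: end bounds `bF`, `bG` with `bF·bG ≤ 2^len · S`
  have key : ∀ {bF bG : ℝ}, 0 ≤ bF → (∀ g, |iterΔ t.sF F (z + t.x) g| ≤ bF) → (∀ f, |iterΔ t.sG G (z + t.y) f| ≤ bG) →
      bF * bG ≤ 2 ^ t.len * (Φ₁ * Γ₀ + Φ₀ * Γ₁ + Φ₁ * Γ₁) →
      |t.eval z F G| ≤ |t.c| * (∑ g, ∑ f, |t.m g f|) * 2 ^ t.len * (Φ₁ * Γ₀ + Φ₀ * Γ₁ + Φ₁ * Γ₁) := by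
    intro bF bG hbF hX hY hprod
    rw [VTerm.eval, abs_mul]
    calc |t.c| * |∑ g, ∑ f, t.m g f * iterΔ t.sF F (z + t.x) g * iterΔ t.sG G (z + t.y) f|
        ≤ |t.c| * ((∑ g, ∑ f, |t.m g f|) * bF * bG) :=
          mul_le_mul_of_nonneg_left (abs_sum_sum_mul_mul_le t.m hbF hX hY) (abs_nonneg _)
      _ = |t.c| * (∑ g, ∑ f, |t.m g f|) * (bF * bG) := by ring
      _ ≤ |t.c| * (∑ g, ∑ f, |t.m g f|) * (2 ^ t.len * (Φ₁ * Γ₀ + Φ₀ * Γ₁ + Φ₁ * Γ₁)) :=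
          mul_le_mul_of_nonneg_left hprod (mul_nonneg (abs_nonneg _) hm)
      _ = _ := by ring
  have h2len : ∀ {j : ℕ}, j ≤ t.len → (2 : ℝ) ^ j ≤ 2 ^ t.len := fun hj => pow_le_pow_right₀ (by norm_num) hj
  rcases hF : t.sF with _ | ⟨a, s⟩ <;> rcases hG : t.sG with _ | ⟨b, s'⟩
  · -- no step at all: excluded by the grading
    exfalso; simp [VTerm.len, hF, hG] at hlen
  · -- steps on the column end only
    have hb : IsStep b := hsG b (by rw [hG]; exact List.mem_cons_self)
    have hs' : ∀ b' ∈ s', IsStep b' := fun b' hb' => hsG b' (by rw [hG]; exact List.mem_cons_of_mem _ hb')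
    have hlen' : t.len = s'.length + 1 := by simp [VTerm.len, hF, hG]
    refine key (bF := Φ₀) (bG := 2 ^ s'.length * Γ₁) hΦ₀ (fun g => ?_) (fun f => ?_) ?_
    · rw [hF, iterΔ_nil]; exact hF₀ _ g (by rw [hx0]; omega)
    · rw [hG]
      exact abs_iterΔ_cons_le z R s' hs' hb G Γ₁ 0 (fun q f i hq => hG₁ q f i (by omega)) _ f
        (by rw [hy0]; rw [hG, List.length_cons] at hRy; omega)
    · calc Φ₀ * (2 ^ s'.length * Γ₁) = 2 ^ s'.length * (Φ₀ * Γ₁) := by ring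
        _ ≤ 2 ^ t.len * (Φ₁ * Γ₀ + Φ₀ * Γ₁ + Φ₁ * Γ₁) :=
          mul_le_mul (h2len (by omega)) (by nlinarith [mul_nonneg hΦ₁ hΓ₀, mul_nonneg hΦ₁ hΓ₁]) (by positivity) (by positivity)
  · -- steps on the row end only
    have ha : IsStep a := hsF a (by rw [hF]; exact List.mem_cons_self)
    have hs : ∀ a' ∈ s, IsStep a' := fun a' ha' => hsF a' (by rw [hF]; exact List.mem_cons_of_mem _ ha')
    have hlen' : t.len = s.length + 1 := by simp [VTerm.len, hF, hG]
    refine key (bF := 2 ^ s.length * Φ₁) (bG := Γ₀) (by positivity) (fun g => ?_) (fun f => ?_) ?_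
    · rw [hF]
      exact abs_iterΔ_cons_le z R s hs ha F Φ₁ 0 (fun q g i hq => hF₁ q g i (by omega)) _ g
        (by rw [hx0]; rw [hF, List.length_cons] at hRx; omega)
    · rw [hG, iterΔ_nil]; exact hG₀ _ f (by rw [hy0]; omega)
    · calc 2 ^ s.length * Φ₁ * Γ₀ = 2 ^ s.length * (Φ₁ * Γ₀) := by ring
        _ ≤ 2 ^ t.len * (Φ₁ * Γ₀ + Φ₀ * Γ₁ + Φ₁ * Γ₁) :=
          mul_le_mul (h2len (by omega)) (by nlinarith [mul_nonneg hΦ₀ hΓ₁, mul_nonneg hΦ₁ hΓ₁]) (by positivity) (by positivity)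
  · -- steps on both ends
    have ha : IsStep a := hsF a (by rw [hF]; exact List.mem_cons_self)
    have hs : ∀ a' ∈ s, IsStep a' := fun a' ha' => hsF a' (by rw [hF]; exact List.mem_cons_of_mem _ ha')
    have hb : IsStep b := hsG b (by rw [hG]; exact List.mem_cons_self)
    have hs' : ∀ b' ∈ s', IsStep b' := fun b' hb' => hsG b' (by rw [hG]; exact List.mem_cons_of_mem _ hb')
    have hlen' : t.len = s.length + 1 + (s'.length + 1) := by simp [VTerm.len, hF, hG]
    refine key (bF := 2 ^ s.length * Φ₁) (bG := 2 ^ s'.length * Γ₁) (by positivity) (fun g => ?_) (fun f => ?_) ?_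
    · rw [hF]
      exact abs_iterΔ_cons_le z R s hs ha F Φ₁ 0 (fun q g i hq => hF₁ q g i (by omega)) _ g
        (by rw [hx0]; rw [hF, List.length_cons] at hRx; omega)
    · rw [hG]
      exact abs_iterΔ_cons_le z R s' hs' hb G Γ₁ 0 (fun q f i hq => hG₁ q f i (by omega)) _ f
        (by rw [hy0]; rw [hG, List.length_cons] at hRy; omega)
    · have hpow : (2 : ℝ) ^ s.length * 2 ^ s'.length ≤ 2 ^ t.len := by
        rw [← pow_add]; exact h2len (by omega)
      calc 2 ^ s.length * Φ₁ * (2 ^ s'.length * Γ₁) = (2 ^ s.length * 2 ^ s'.length) * (Φ₁ * Γ₁) := by ring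
        _ ≤ 2 ^ t.len * (Φ₁ * Γ₀ + Φ₀ * Γ₁ + Φ₁ * Γ₁) :=
          mul_le_mul hpow (by nlinarith [mul_nonneg hΦ₁ hΓ₀, mul_nonneg hΦ₀ hΓ₁]) (by positivity) (by positivity)

/-- [folklore] **THE WINDOW ESTIMATE FOR A LIST OF GRADING 1.**  There are `K ≥ 0` and a window radius `R` (depending only on the list) such that for
every base point `z` and all end functions `F`, `G` whose values ∕ forward unit differences are bounded on the window `‖q − z‖∞ ≤ R` by `Φ₀ ∕ Φ₁`
resp. `Γ₀ ∕ Γ₁`:  `|vtx z L F G| ≤ K · (Φ₁·Γ₀ + Φ₀·Γ₁ + Φ₁·Γ₁)` — at least one difference always lands on an end. -/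
theorem exists_vtx_bound_of_graded_one {L : Stn I} (h : Graded 1 L) :
    ∃ (K : ℝ) (R : ℕ), 0 ≤ K ∧ ∀ (z : Pt) (F G : Pt → I → ℝ) (Φ₀ Φ₁ Γ₀ Γ₁ : ℝ), 0 ≤ Φ₀ → 0 ≤ Φ₁ → 0 ≤ Γ₀ → 0 ≤ Γ₁ →
      (∀ (q : Pt) (g : I), supNorm (q - z) ≤ R → |F q g| ≤ Φ₀) →
      (∀ (q : Pt) (g : I) (i : Fin 4), supNorm (q - z) ≤ R → |F (q + unitVec i) g - F q g| ≤ Φ₁) →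
      (∀ (q : Pt) (f : I), supNorm (q - z) ≤ R → |G q f| ≤ Γ₀) →
      (∀ (q : Pt) (f : I) (i : Fin 4), supNorm (q - z) ≤ R → |G (q + unitVec i) f - G q f| ≤ Γ₁) →
      |vtx z L F G| ≤ K * (Φ₁ * Γ₀ + Φ₀ * Γ₁ + Φ₁ * Γ₁) := by
  obtain ⟨Ts, hTs, hev⟩ := exists_vterms_of_graded h
  refine ⟨(Ts.map fun t => |t.c| * (∑ g, ∑ f, |t.m g f|) * 2 ^ t.len).sum,
    (Ts.map fun t => supNorm t.x + 2 * t.sF.length + supNorm t.y + 2 * t.sG.length).sum,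
    list_sum_nonneg Ts fun t _ => by positivity, ?_⟩
  intro z F G Φ₀ Φ₁ Γ₀ Γ₁ h0 h1 h2 h3 hF₀ hF₁ hG₀ hG₁
  rw [hev z F G, ← List.sum_map_mul_right]
  refine (list_abs_sum_le Ts _).trans (list_sum_le_sum Ts fun t ht => ?_)
  obtain ⟨hlen, hsF, hsG⟩ := hTs t ht
  have hR := list_le_sum_nat Ts (fun t => supNorm t.x + 2 * t.sF.length + supNorm t.y + 2 * t.sG.length) ht
  exact abs_eval_le z _ t hlen hsF hsG (by omega) (by omega) h0 h1 h2 h3 hF₀ hF₁ hG₀ hG₁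

end Bound

/-! ## §5 The instance: the transverse-completed Wilson sector `SbT` is ONE realised list of grading 1 (leaf-03-g12's `GluonBubbleTails`) -/

section SbTInstance

/-- [folklore] **THE FRAME OF THE SIX `SbT` PIECES OF T₁ ∕ T₂ — THE TRANSVERSE WILSON SECTOR AGAINST A RANK-ONE PARTNER.**  There are `K ≥ 0` and a
window radius `R` (absolute: they depend only on the four lists `vec₀ κ ++ rem₀ κ`; `GluonBubbleTails.SbT_eq_realK`, `graded_SbT_list`) such that for every bond `(κ, u)`, all legs `A`, `B`, every rank-one
partner `φ ⊗ ψ` whose row end `ψA` is termwise summable, and all window bounds `Φ₀ ∕ Φ₁` (values ∕ forward unit differences of the row end `ψA` on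
`‖q − u‖∞ ≤ R`) and `Γ₀ ∕ Γ₁` (of the column end `Bφ`):
`|biBubble A (SbT κ u) B (φ ⊗ ψ)| ≤ K · (Φ₁·Γ₀ + Φ₀·Γ₁ + Φ₁·Γ₁)`.  The vertex's one difference always lands on a leg end; `Φ₀Γ₀` never occurs. -/
theorem exists_SbT_outer_bound :
    ∃ (K : ℝ) (R : ℕ), 0 ≤ K ∧ ∀ (κ : Fin 4) (u : Pt) (A B : MKer 4 (Fin 4)) (φ ψ : Pt → Fin 4 → ℝ),
      (∀ (s : Pt) (g : Fin 4), Summable fun x : Pt => ∑ a, ψ x a * A x s a g) →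
      ∀ (Φ₀ Φ₁ Γ₀ Γ₁ : ℝ), 0 ≤ Φ₀ → 0 ≤ Φ₁ → 0 ≤ Γ₀ → 0 ≤ Γ₁ →
      (∀ (q : Pt) (g : Fin 4), supNorm (q - u) ≤ R → |applyKT ψ A q g| ≤ Φ₀) →
      (∀ (q : Pt) (g : Fin 4) (i : Fin 4), supNorm (q - u) ≤ R → |applyKT ψ A (q + unitVec i) g - applyKT ψ A q g| ≤ Φ₁) →
      (∀ (q : Pt) (f : Fin 4), supNorm (q - u) ≤ R → |applyK B φ q f| ≤ Γ₀) →
      (∀ (q : Pt) (f : Fin 4) (i : Fin 4), supNorm (q - u) ≤ R → |applyK B φ (q + unitVec i) f - applyK B φ q f| ≤ Γ₁) →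
      |biBubble A (SbT κ u) B (outer φ ψ)| ≤ K * (Φ₁ * Γ₀ + Φ₀ * Γ₁ + Φ₁ * Γ₁) := by
  have h := fun κ : Fin 4 => exists_vtx_bound_of_graded_one (I := Fin 4) (graded_SbT_list κ)
  choose K R hK hb using h
  refine ⟨∑ κ, K κ, Finset.univ.sup R, sum_nonneg fun κ _ => hK κ,
    fun κ u A B φ ψ hψA Φ₀ Φ₁ Γ₀ Γ₁ h0 h1 h2 h3 hF₀ hF₁ hG₀ hG₁ => ?_⟩
  rw [SbT_eq_realK, biBubble_realK_outer A B u _ φ ψ hψA]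
  have hRκ : R κ ≤ Finset.univ.sup R := Finset.le_sup (mem_univ κ)
  have hS : 0 ≤ Φ₁ * Γ₀ + Φ₀ * Γ₁ + Φ₁ * Γ₁ := by positivity
  refine (hb κ u _ _ Φ₀ Φ₁ Γ₀ Γ₁ h0 h1 h2 h3 (fun q g hq => hF₀ q g (hq.trans hRκ)) (fun q g i hq => hF₁ q g i (hq.trans hRκ))
    (fun q f hq => hG₀ q f (hq.trans hRκ)) (fun q f i hq => hG₁ q f i (hq.trans hRκ))).trans ?_
  exact mul_le_mul_of_nonneg_right (single_le_sum (f := K) (fun κ _ => hK κ) (mem_univ κ)) hS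

end SbTInstance

end Summit.QuantumFields.BalabanUV.Beta.D1BFx.LocalVertexForm
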